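import Literature.Analysis.FunctionSpaces.TorusSeriesCalculus
import Literature.Analysis.FunctionSpaces.TorusScalarTrigPoly
import Literature.Analysis.FunctionSpaces.TorusSpectralWeakDerivative
import Literature.Analysis.FunctionSpaces.TorusLerayHelmholtzProofs
import HarnessLib

/-!
# Liouville laminar states I: real Fourier modes and rapidly decaying mode series (solo-informed)

Generic calculus on `T^d` used by `SoloInformedLiouvilleStates`: the real scalar mode
`M_k(z)(x) = Re (z e_k(x))` (`e_k = UnitAddTorus.mFourier k`), its derivatives
(`∂ⱼ M_k(z) = M_k(2πi kⱼ z)`, `Δ M_k(z) = -4π²|k|² M_k(z)`), its Fourier coefficients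
(`z/2` at `k`, `z̄/2` at `-k`), the bound `‖D^m M_k(z)‖ ≤ |z| (2π(1+|k|²))^m`; and mode series
`∑_n M_{k_n}(z_n)` with rapidly decaying coefficients (`∑_n |z_n| (2π(1+|k_n|²))^m < ∞` for all
`m`): smoothness and termwise differentiation (through the tree's `Torus.SummableLiftBounds`),
termwise Fourier coefficients, zero mean, and the coefficient `z_{n₀}/2` at an injectively placed
frequency.  Everything here is textbook Fourier analysis on the torus.

References: L. Grafakos, *Classical Fourier Analysis*, 3rd ed. (2014), Prop. 3.2.6–3.2.7, 3.3.12
[Grafakos2014].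
-/

noncomputable section

open MeasureTheory Filter Topology Set UnitAddTorus
open scoped ENNReal NNReal InnerProductSpace Real ComplexConjugate

namespace Summit.AnomalousDissipation.AnomalousDissipation.Theorems

open Literature.Analysis.FunctionSpaces Literature.Analysis.FunctionSpaces.Torus

/-! ## Real Fourier modes on `T^d` -/

section Modes

variable {d : Type*} [Fintype d] [DecidableEq d]

/-- The real scalar mode `M_k(z)(x) = Re (e_k(x) z)` on `T^d`. [folklore] -/
def rmode (k : d → ℤ) (z : ℂ) : UnitAddTorus d → ℝ := fun x => (mFourier k x * z).re

omit [DecidableEq d] in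
/-- Evaluation of a real mode. [folklore] -/
theorem rmode_apply (k : d → ℤ) (z : ℂ) (x : UnitAddTorus d) :
    rmode k z x = (mFourier k x * z).re := rfl

omit [DecidableEq d] in
/-- A real mode is the one-term real trigonometric polynomial of the tree. [folklore] -/
theorem rmode_eq_reTrigPoly (k : d → ℤ) (z : ℂ) : rmode k z = reTrigPoly {k} (fun _ => z) := by
  funext x
  rw [reTrigPoly_singleton_apply, rmode_apply]

omit [DecidableEq d] in
/-- Modes are smooth. [folklore] -/
theorem isSmooth_rmode (k : d → ℤ) (z : ℂ) : IsSmooth (rmode k z) := by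
  rw [rmode_eq_reTrigPoly]; exact isSmooth_reTrigPoly _ _

omit [DecidableEq d] in
/-- `|M_k(z)(x)| ≤ |z|`. [folklore] -/
theorem abs_rmode_le (k : d → ℤ) (z : ℂ) (x : UnitAddTorus d) : |rmode k z x| ≤ ‖z‖ := by
  rw [rmode_apply]
  refine (Complex.abs_re_le_norm _).trans ?_
  rw [norm_mul, norm_mFourier_apply, one_mul]

omit [DecidableEq d] in
/-- `‖M_k(z)(x)‖ ≤ |z|`. [folklore] -/
theorem norm_rmode_le (k : d → ℤ) (z : ℂ) (x : UnitAddTorus d) : ‖rmode k z x‖ ≤ ‖z‖ := by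
  rw [Real.norm_eq_abs]; exact abs_rmode_le k z x

omit [DecidableEq d] in
/-- Additivity in the coefficient. [folklore] -/
theorem rmode_add (k : d → ℤ) (z w : ℂ) (x : UnitAddTorus d) :
    rmode k (z + w) x = rmode k z x + rmode k w x := by
  simp only [rmode_apply, mul_add, Complex.add_re]

omit [DecidableEq d] in
/-- Real homogeneity in the coefficient. [folklore] -/
theorem rmode_ofReal_mul (k : d → ℤ) (r : ℝ) (z : ℂ) (x : UnitAddTorus d) :
    rmode k ((r : ℂ) * z) x = r * rmode k z x := by
  simp only [rmode_apply]
  rw [mul_left_comm, Complex.re_ofReal_mul]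

omit [DecidableEq d] in
/-- Real modes are additive in the coefficient (finite sums). [folklore] -/
theorem rmode_sum {ι : Type*} (s : Finset ι) (k : d → ℤ) (z : ι → ℂ) (x : UnitAddTorus d) :
    rmode k (∑ i ∈ s, z i) x = ∑ i ∈ s, rmode k (z i) x := by
  simp only [rmode_apply, Finset.mul_sum, Complex.re_sum]

/-- **Partial derivatives act diagonally**: `∂ⱼ M_k(z) = M_k(2πi kⱼ z)`. [cite: Grafakos2014, Prop. 3.2.6 (8)] -/
theorem partialDeriv_rmode (k : d → ℤ) (z : ℂ) (j : d) (x : UnitAddTorus d) :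
    partialDeriv j (rmode k z) x = rmode k (2 * Real.pi * Complex.I * (k j) * z) x := by
  rw [rmode_eq_reTrigPoly, partialDeriv_reTrigPoly, reTrigPoly_singleton_apply, rmode_apply, smul_eq_mul]

/-- **Modes are eigenfunctions of the Laplacian**: `Δ M_k(z) = -4π²|k|² M_k(z)`.
[cite: Grafakos2014, Prop. 3.2.6 (8)] -/
theorem laplacian_rmode (k : d → ℤ) (z : ℂ) (x : UnitAddTorus d) :
    laplacian (rmode k z) x = -(4 * Real.pi ^ 2 * freqNormSq k) * rmode k z x := by
  rw [rmode_eq_reTrigPoly, laplacian_reTrigPoly_singleton]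

omit [DecidableEq d] in
/-- **Derivative bounds of a mode on the lift**: `‖Dᵐ (M_k(z) ∘ proj)‖ ≤ |z| (2π(1+|k|²))ᵐ`.
[cite: Grafakos2014, Prop. 3.3.12] -/
theorem norm_iteratedFDeriv_lift_rmode_le (k : d → ℤ) (z : ℂ) (m : ℕ) (y : EuclideanSpace ℝ d) :
    ‖iteratedFDeriv ℝ m (lift (rmode k z)) y‖ ≤ ‖z‖ * (2 * Real.pi * (1 + freqNormSq k)) ^ m := by
  set L : ℂ →L[ℝ] ℝ := Complex.reCLM.comp ((ContinuousLinearMap.id ℝ ℂ).smulRight z) with hL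
  have hcomp : lift (rmode k z) = ⇑L ∘ fun y : EuclideanSpace ℝ d => mFourier k (proj y) := by
    funext y
    simp only [hL, Torus.lift_apply, rmode_apply, Function.comp_apply, ContinuousLinearMap.comp_apply,
      ContinuousLinearMap.smulRight_apply, ContinuousLinearMap.id_apply, Complex.reCLM_apply,
      smul_eq_mul]
  have hLn : ‖L‖ ≤ ‖z‖ := by
    refine ContinuousLinearMap.opNorm_le_bound _ (norm_nonneg _) fun w => ?_
    simp only [hL, ContinuousLinearMap.comp_apply, ContinuousLinearMap.smulRight_apply,
      ContinuousLinearMap.id_apply, Complex.reCLM_apply, smul_eq_mul]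
    refine (Complex.abs_re_le_norm _).trans ?_
    rw [norm_mul, mul_comm]
  rw [hcomp]
  refine (ContinuousLinearMap.norm_iteratedFDeriv_comp_left _ ((isSmooth_mFourier k).contDiffAt)
    (mod_cast le_top)).trans ?_
  exact mul_le_mul hLn (norm_iteratedFDeriv_mFourier_proj_le k m y) (norm_nonneg _) (norm_nonneg _)

omit [DecidableEq d] in
/-- The complexified mode: `M_k(z) = (z e_k + conj z · e_{-k})/2`. [folklore] -/
theorem ofReal_rmode (k : d → ℤ) (z : ℂ) (x : UnitAddTorus d) :
    ((rmode k z x : ℝ) : ℂ) = mFourier k x * (z / 2) + mFourier (-k) x * (conj z / 2) := by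
  rw [rmode_apply, Complex.re_eq_add_conj, map_mul, ← mFourier_neg]
  ring

omit [DecidableEq d] in
/-- **Fourier coefficients of a mode**: `𝓕(M_k(z))(K) = [K = k] z/2 + [K = -k] conj z/2`.
[cite: Grafakos2014, Prop. 3.2.7 (1)] -/
theorem mFourierCoeff_ofReal_rmode (k : d → ℤ) (z : ℂ) (K : d → ℤ) :
    mFourierCoeff (fun x => ((rmode k z x : ℝ) : ℂ)) K =
      (if K = k then z / 2 else 0) + (if K = -k then conj z / 2 else 0) := by
  rw [mFourierCoeff_eq_integral_volume]
  simp_rw [ofReal_rmode, smul_eq_mul, mul_add, ← mul_assoc]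
  have hi : ∀ l : d → ℤ, ∀ c : ℂ,
      Integrable (fun x : UnitAddTorus d => mFourier (-K) x * mFourier l x * c) volume := fun l c =>
    (((mFourier (-K)).continuous.mul (mFourier l).continuous).mul continuous_const).integrable_unitAddTorus
  rw [integral_add (hi k _) (hi (-k) _), integral_mul_const, integral_mul_const,
    integral_mFourier_neg_mul_mFourier, integral_mFourier_neg_mul_mFourier]
  split_ifs <;> simp

omit [DecidableEq d] in
/-- Modes with non-zero frequency have zero mean. [folklore] -/
theorem integral_rmode (k : d → ℤ) (hk : k ≠ 0) (z : ℂ) : ∫ x, rmode k z x = 0 := by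
  have hint : Integrable (fun x : UnitAddTorus d => mFourier k x * z) volume :=
    ((mFourier k).continuous.mul continuous_const).integrable_unitAddTorus
  have h1 : ∫ x, mFourier k x * z = 0 := by
    rw [integral_mul_const]
    have h := integral_mFourier_neg_mul_mFourier (0 : d → ℤ) k
    rw [if_neg (Ne.symm hk)] at h
    simp only [neg_zero, mFourier_zero, ContinuousMap.one_apply, one_mul] at h
    rw [h, zero_mul]
  have h2 : ∫ x, rmode k z x = (∫ x, mFourier k x * z).re := by
    have h := Complex.reCLM.integral_comp_comm hint
    simp only [Complex.reCLM_apply] at h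
    simpa only [rmode_apply] using h
  rw [h2, h1, Complex.zero_re]

end Modes

/-! ## Series of modes with rapidly decaying coefficients -/

section Series

variable {d : Type*} [Fintype d] [DecidableEq d]

/-- Rapid decay of a coefficient sequence `z` placed on frequencies `k`:
`∑_n |z_n| (2π(1+|k_n|²))^m < ∞` for every `m`. [cite: Grafakos2014, Prop. 3.3.12] -/
def RapidDecay (k : ℕ → d → ℤ) (z : ℕ → ℂ) : Prop :=
  ∀ m : ℕ, Summable fun n => ‖z n‖ * (2 * Real.pi * (1 + freqNormSq (k n))) ^ m

/-- The mode series `x ↦ ∑_n M_{k_n}(z_n)(x)`. [folklore] -/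
def modeSeries (k : ℕ → d → ℤ) (z : ℕ → ℂ) : UnitAddTorus d → ℝ :=
  fun x => ∑' n, rmode (k n) (z n) x

variable {k : ℕ → d → ℤ} {z : ℕ → ℂ}

omit [DecidableEq d] in
/-- Rapidly decaying coefficients are absolutely summable (`m = 0`). [folklore] -/
theorem RapidDecay.summable_norm (h : RapidDecay k z) : Summable fun n => ‖z n‖ := by
  simpa using h 0

omit [DecidableEq d] in
/-- Rapid decay gives summable lift bounds for the mode family. [cite: Grafakos2014, Prop. 3.3.12] -/
theorem RapidDecay.summableLiftBounds (h : RapidDecay k z) :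
    SummableLiftBounds (fun n => rmode (k n) (z n)) :=
  SummableLiftBounds.of_norm_iteratedFDeriv_le (fun _ => isSmooth_rmode _ _) h
    fun _ _ _ => norm_iteratedFDeriv_lift_rmode_le _ _ _ _

omit [DecidableEq d] in
/-- The mode series is smooth. [cite: Grafakos2014, Prop. 3.3.12] -/
theorem RapidDecay.isSmooth_modeSeries (h : RapidDecay k z) : IsSmooth (modeSeries k z) :=
  h.summableLiftBounds.isSmooth_tsum

omit [DecidableEq d] in
/-- Pointwise summability of a mode series with summable coefficients. [folklore] -/
theorem summable_rmode_apply (h : Summable fun n => ‖z n‖) (x : UnitAddTorus d) :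
    Summable fun n => rmode (k n) (z n) x :=
  Summable.of_norm_bounded h fun _ => norm_rmode_le _ _ _

omit [DecidableEq d] in
/-- Pointwise bound `|∑_n M_{k_n}(z_n)(x)| ≤ ∑_n |z_n|`. [folklore] -/
theorem abs_modeSeries_le (h : Summable fun n => ‖z n‖) (x : UnitAddTorus d) :
    |modeSeries k z x| ≤ ∑' n, ‖z n‖ := by
  rw [← Real.norm_eq_abs]
  exact tsum_of_norm_bounded h.hasSum fun n => norm_rmode_le _ _ _

/-- `∂ⱼ ∑_n M_{k_n}(z_n) = ∑_n M_{k_n}(2πi (k_n)ⱼ z_n)`. [cite: Grafakos2014, Prop. 3.2.6 (8)] -/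
theorem RapidDecay.partialDeriv_modeSeries (h : RapidDecay k z) (j : d) (x : UnitAddTorus d) :
    partialDeriv j (modeSeries k z) x = ∑' n, rmode (k n) (2 * Real.pi * Complex.I * (k n j) * z n) x := by
  unfold modeSeries
  rw [h.summableLiftBounds.partialDeriv_tsum_apply j x]
  exact tsum_congr fun n => partialDeriv_rmode _ _ _ _

/-- `Δ ∑_n M_{k_n}(z_n) = ∑_n -4π²|k_n|² M_{k_n}(z_n)`. [cite: Grafakos2014, Prop. 3.2.6 (8)] -/
theorem RapidDecay.laplacian_modeSeries (h : RapidDecay k z) (x : UnitAddTorus d) :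
    laplacian (modeSeries k z) x = ∑' n, -(4 * Real.pi ^ 2 * freqNormSq (k n)) * rmode (k n) (z n) x := by
  unfold modeSeries
  rw [h.summableLiftBounds.laplacian_tsum_apply x]
  exact tsum_congr fun n => laplacian_rmode _ _ _

omit [DecidableEq d] in
/-- **Fourier coefficients of a mode series** (termwise integration of the uniformly convergent
series). [cite: Grafakos2014, Prop. 3.2.7 (1)] -/
theorem mFourierCoeff_modeSeries (h : Summable fun n => ‖z n‖) (K : d → ℤ) :
    mFourierCoeff (fun x => ((modeSeries k z x : ℝ) : ℂ)) K =
      ∑' n, ((if K = k n then z n / 2 else 0) + (if K = -k n then conj (z n) / 2 else 0)) := by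
  have hterm : ∀ n, mFourierCoeff (fun x => ((rmode (k n) (z n) x : ℝ) : ℂ)) K =
      (if K = k n then z n / 2 else 0) + (if K = -k n then conj (z n) / 2 else 0) := fun n =>
    mFourierCoeff_ofReal_rmode _ _ _
  simp_rw [← hterm, mFourierCoeff_eq_integral_volume, smul_eq_mul]
  have h1 : ∀ x : UnitAddTorus d, mFourier (-K) x * ((modeSeries k z x : ℝ) : ℂ) =
      ∑' n, mFourier (-K) x * ((rmode (k n) (z n) x : ℝ) : ℂ) := fun x => by
    rw [modeSeries, Complex.ofReal_tsum, ← tsum_mul_left]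
  simp_rw [h1]
  have hint : ∀ n, Integrable (fun x : UnitAddTorus d =>
      mFourier (-K) x * ((rmode (k n) (z n) x : ℝ) : ℂ)) volume := fun n =>
    ((mFourier (-K)).continuous.mul
      (Complex.continuous_ofReal.comp (isSmooth_rmode (k n) (z n)).continuous)).integrable_unitAddTorus
  refine (integral_tsum_of_summable_integral_norm hint ?_).symm
  refine Summable.of_nonneg_of_le (fun n => integral_nonneg fun x => norm_nonneg _) (fun n => ?_) h
  have hle : ∀ x : UnitAddTorus d, ‖mFourier (-K) x * ((rmode (k n) (z n) x : ℝ) : ℂ)‖ ≤ ‖z n‖ :=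
    fun x => by
    rw [norm_mul, norm_mFourier_apply, one_mul, Complex.norm_real]
    exact norm_rmode_le _ _ _
  calc ∫ x, ‖mFourier (-K) x * ((rmode (k n) (z n) x : ℝ) : ℂ)‖ ≤ ∫ x : UnitAddTorus d, ‖z n‖ :=
        integral_mono (hint n).norm (integrable_const _) hle
    _ = ‖z n‖ := by simp

omit [DecidableEq d] in
/-- On injectively placed frequencies avoiding each other's negatives, the coefficient of the series
at `k_{n₀}` is `z_{n₀}/2`. [folklore] -/
theorem mFourierCoeff_modeSeries_eq (h : Summable fun n => ‖z n‖) (hinj : Function.Injective k)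
    (hneg : ∀ m n, k m ≠ -k n) (n₀ : ℕ) :
    mFourierCoeff (fun x => ((modeSeries k z x : ℝ) : ℂ)) (k n₀) = z n₀ / 2 := by
  rw [mFourierCoeff_modeSeries h, tsum_eq_single n₀]
  · rw [if_pos rfl, if_neg (hneg n₀ n₀), add_zero]
  · intro n hn
    rw [if_neg (fun h' => hn (hinj h').symm), if_neg (hneg n₀ n), add_zero]

omit [DecidableEq d] in
/-- A mode series on non-zero frequencies has zero mean. [folklore] -/
theorem hasZeroMean_modeSeries (h : Summable fun n => ‖z n‖) (hk : ∀ n, k n ≠ 0) :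
    HasZeroMean (modeSeries k z) := by
  unfold HasZeroMean modeSeries
  have hint : ∀ n, Integrable (fun x : UnitAddTorus d => rmode (k n) (z n) x) volume := fun n =>
    (isSmooth_rmode (k n) (z n)).continuous.integrable_unitAddTorus
  rw [← integral_tsum_of_summable_integral_norm hint]
  · simp [integral_rmode _ (hk _)]
  · refine Summable.of_nonneg_of_le (fun n => integral_nonneg fun x => norm_nonneg _) (fun n => ?_) h
    calc ∫ x, ‖rmode (k n) (z n) x‖ ≤ ∫ x : UnitAddTorus d, ‖z n‖ :=
          integral_mono (hint n).norm (integrable_const _) fun x => norm_rmode_le _ _ _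
      _ = ‖z n‖ := by simp

end Series

section Coeff

/-- `‖(2πi a) (z/2)‖² = π² a² |z|²`. [folklore] -/
theorem norm_sq_coeff (a : ℤ) (z : ℂ) :
    ‖(2 * Real.pi * Complex.I * (a : ℂ)) • (z / 2)‖ ^ 2 = Real.pi ^ 2 * (a : ℝ) ^ 2 * ‖z‖ ^ 2 := by
  rw [norm_smul, norm_div, norm_mul, norm_mul, norm_mul, Complex.norm_I, Complex.norm_intCast,
    Complex.norm_real, Real.norm_eq_abs, abs_of_pos Real.pi_pos]
  have h2 : ‖(2 : ℂ)‖ = 2 := by simp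
  rw [h2, show 2 * Real.pi * 1 * |(a : ℝ)| * (‖z‖ / 2) = Real.pi * |(a : ℝ)| * ‖z‖ by ring,
    mul_pow, mul_pow, sq_abs]

end Coeff

end Summit.AnomalousDissipation.AnomalousDissipation.Theorems

end
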